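import Literature.NumberTheory.LFunctions.WeilBochnerRepresentationRH
import Literature.NumberTheory.LFunctions.ZetaFirstZeroCertificate
import Summits.RiemannHypothesis.RiemannHypothesis.Theorems.HandoffEdgeLayer
import HarnessLib

/-!
# HANDOFF, FILE XII-w: the MELLIN PINNING inequality — under RH every non-trivial zero `ρ` satisfies `m(ρ)·|ĝ(ρ)|² ≤ Re Q(g)` for EVERY test `g`; on the handoff window `|ĝ(ρ)|² ≤ contribution_q(g) − deficit_q(g)`; and the all-`g` form of the inequality IS RH

HONEST FRAMING. Nothing here proves or approaches RH. This file types the logical status of the «Mellin picture» of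
HOME/handoff/theory-2/edgesign/REPORT.md §4m (theory-2 gen9; referee r37 HS-33 (j)): a certified near-null / wall vector `g`
of the `{p < q}`-semilocal Weil form has a transform `ĝ(½ + iτ)` whose zeros sit ON the Riemann zeros «as deep as the energy
budget allows». The kernel sentences:

* §1 (RH side, Literature objects only). Under RH, Weil's form is the integral of `|ĝ(½+it)|²` against the zero-height
  measure `ν = Σ_ρ m(ρ) δ_{Im ρ}` (tree: `WeilBochner.weilQuadratic_eq_integral_of_riemannHypothesis`, Bombieri 2000 §3 (3.2));
  dropping all but finitely many atoms gives the **PINNING INEQUALITY**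
  `Σ_{ρ ∈ Z} m(ρ)·‖ĝ(ρ)‖² ≤ Re Q(g)` for every finite set `Z` of non-trivial zeros and every test `g`
  (`sum_zeroOrder_mul_norm_sq_weilMellin_le`), in particular `‖ĝ(ρ)‖² ≤ Re Q(g)` at every zero
  (`norm_sq_weilMellin_le`): a vector whose Weil energy is `η` has `|ĝ| ≤ √η` at EVERY zero, and the budget `η` is SHARED by
  the zeros — the bookkeeping REPORT §4m (a)/(c) uses.
* §2 (status). The all-`g`, all-`ρ` form of the inequality is EQUIVALENT to RH (`riemannHypothesis_iff_forall_norm_sq_weilMellin_le`;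
  `←` through the tree's certified first zero `ZetaFirstZeroCertificate.exists_zero_Icc_first_bracket` and Weil's criterion
  `weil_criterion_holds`): like every other `∀`-structure statement of the track it is RH, not a route around it; and a single test
  `g` with a single zero `ρ` violating it REFUTES RH (`not_riemannHypothesis_of_lt`) — the falsifiable reading of the picture.
* §3 (handoff window face). For consecutive primes `q < q'` and `g ∈ C(b)`, `b ≤ (log q')/2`, the tree's window identity
  `Re Q(g) = contribution_q(g) − deficit_q(g)` (`Handoff.re_weilQuadratic_eq_contribution_sub_deficit`, prove-2) turns §1 into
  `Σ_{ρ∈Z} m(ρ)‖ĝ(ρ)‖² ≤ contribution_q(g) − deficit_q(g) ≤ Re Q_{S_q}(g) + cap(q)‖g‖₂²` (`cap(q) = (log q)/√q`, the tree's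
  `HandoffEdgeLayer.abs_contribution_le_of_window`): the deleted form's bottom value plus the one-atom contribution is the whole
  budget — exactly `Q(g_N) = ε₁‖g‖² + w_q·m·‖g‖²_Λ` of REPORT §4m (a) (the finer layer form of the contribution is XII-q's
  `contribution_eq_layer`, not imported here: unbuilt on the check farm).

So the measured pinning is what the explicit formula FORCES, under RH, of ANY vector with a small form; measured against the TABLE
of on-line zeros it neither tests nor uses the horizontal position of any zero. RH enters §1/§3 as a HYPOTHESIS (labelled in every
name); §2 and the refutation form are unconditional. No new definitions. Seat rh-explicit-handoff-theory-2 (gen10).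

References: E. Bombieri, Rend. Mat. Acc. Lincei (9) 11 (2000) Thm 1–2, §3 eq. (3.2) [Bombieri2000Weil]; A. Weil (1952)
[Weil1952FormulesExplicites]; H. M. Edwards, Riemann's Zeta Function (1974) §6.6 (the first zero) [Edwards1974].
-/

set_option linter.dupNamespace false  -- the mandated namespace repeats `RiemannHypothesis`

noncomputable section

open Complex Set Filter MeasureTheory Literature.NumberTheory.LFunctions
open Literature.NumberTheory.LFunctions.ZetaZeros Literature.NumberTheory.LFunctions.ZetaZeros.riemannZetaNontrivialZeros
open Literature.NumberTheory.LFunctions.WeilBochner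
open Summit.RiemannHypothesis.RiemannHypothesis.Theorems.Handoff
open Summit.RiemannHypothesis.RiemannHypothesis.Theorems.HandoffEdgeLayer (abs_contribution_le_of_window)
open scoped Real Topology ComplexConjugate ENNReal

namespace Summit.RiemannHypothesis.RiemannHypothesis.Theorems.HandoffMellinPinning

variable {g : ℝ → ℂ}

/-! ## §1 The pinning inequality under RH -/

/-- Under RH a non-trivial zero lies on the critical line: `ρ = ½ + i·Im ρ` (Mathlib's `RiemannHypothesis`; the trivial zeros and
`s = 1` are excluded by `0 < Re ρ`). [folklore] -/
theorem eq_half_add_im_of_riemannHypothesis (hRH : _root_.RiemannHypothesis) {ρ : ℂ}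
    (hρ : ρ ∈ riemannZetaNontrivialZeros) : ρ = 1 / 2 + (ρ.im : ℂ) * I := by
  have hre : ρ.re = 1 / 2 := by
    refine hRH ρ (zeta_eq_zero hρ) ?_ (ne_one hρ)
    rintro ⟨n, rfl⟩
    have h0 := re_pos hρ
    have e : (-2 * ((n : ℂ) + 1)) = ((-2 * ((n : ℝ) + 1) : ℝ) : ℂ) := by push_cast; ring
    rw [e, Complex.ofReal_re] at h0
    have : (0 : ℝ) ≤ n := n.cast_nonneg
    linarith
  apply Complex.ext
  · simp [hre]
  · simp

/-- The multiplicity of a non-trivial zero as a natural number equals the integer order (it is `≥ 1`). [folklore] -/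
theorem toNat_zeroOrder_cast {ρ : ℂ} (hρ : ρ ∈ riemannZetaNontrivialZeros) :
    (((riemannZetaZeroOrder ρ).toNat : ℕ) : ℝ) = (riemannZetaZeroOrder ρ : ℝ) := by
  have h1 : (((riemannZetaZeroOrder ρ).toNat : ℕ) : ℤ) = riemannZetaZeroOrder ρ :=
    Int.toNat_of_nonneg (by linarith [one_le_order hρ])
  rw [← Int.cast_natCast, h1]

/-- **THE PINNING INEQUALITY (finite form).** Under RH, for every Weil test function `g` and every finite set `Z` of (distinct)
non-trivial zeros, `Σ_{ρ ∈ Z} m(ρ)·‖ĝ(ρ)‖² ≤ Re Q(g) = Re W(g ⋆ g̃)`: the Weil energy of `g` is a budget SHARED by all the zeros at which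
`ĝ` fails to vanish. (Weil's explicit formula for `g ⋆ g̃` under RH is `Q(g) = Σ_ρ m(ρ)‖ĝ(ρ)‖²`, a sum of non-negative terms —
tree `WeilBochner.weilQuadratic_eq_integral_of_riemannHypothesis`; drop the atoms outside `Z`.) [cite: Bombieri2000Weil, §3 eq. (3.2)] -/
theorem sum_zeroOrder_mul_norm_sq_weilMellin_le (hRH : _root_.RiemannHypothesis) (hg : IsWeilTest g)
    (Z : Finset riemannZetaNontrivialZeros) :
    ∑ ρ ∈ Z, (riemannZetaZeroOrder (ρ : ℂ) : ℝ) * ‖weilMellin g ρ‖ ^ 2 ≤ (weilQuadratic g).re := by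
  obtain ⟨hint, hQ⟩ := weilQuadratic_eq_integral_of_riemannHypothesis hRH hg
  set F : ℝ → ℝ := fun t ↦ ‖weilMellin g (1 / 2 + t * I)‖ ^ 2 with hF
  have hFc : Continuous F := by
    have h1 : Continuous fun t : ℝ ↦ (1 / 2 : ℂ) + t * I := by fun_prop
    exact ((continuous_weilMellin hg.1.continuous hg.2).comp h1).norm.pow 2
  have hF0 : ∀ t, 0 ≤ F t := fun t ↦ by positivity
  have hQre : (weilQuadratic g).re = ∫ t, F t ∂zetaZeroHeightMeasure := by
    rw [hQ, Complex.ofReal_re]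
  -- the integral as a `lintegral`, and the `lintegral` as the sum over the zeros
  have hIl : ∫ t, F t ∂zetaZeroHeightMeasure = (∫⁻ t, ENNReal.ofReal (F t) ∂zetaZeroHeightMeasure).toReal :=
    integral_eq_lintegral_of_nonneg_ae (ae_of_all _ hF0) hFc.aestronglyMeasurable
  have hlin : ∫⁻ t, ENNReal.ofReal (F t) ∂zetaZeroHeightMeasure =
      ∑' ρ : riemannZetaNontrivialZeros,
        ((riemannZetaZeroOrder (ρ : ℂ)).toNat : ℝ≥0∞) * ENNReal.ofReal (F (ρ : ℂ).im) :=
    lintegral_zetaZeroHeightMeasure hFc.measurable.ennreal_ofReal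
  have hfin : ∫⁻ t, ENNReal.ofReal (F t) ∂zetaZeroHeightMeasure ≠ ⊤ :=
    ((hasFiniteIntegral_iff_ofReal (ae_of_all _ hF0)).1 hint.hasFiniteIntegral).ne
  -- the finite partial sum is below the `tsum`
  have hle : ∑ ρ ∈ Z, ((riemannZetaZeroOrder (ρ : ℂ)).toNat : ℝ≥0∞) * ENNReal.ofReal (F (ρ : ℂ).im) ≤
      ∫⁻ t, ENNReal.ofReal (F t) ∂zetaZeroHeightMeasure := by
    rw [hlin]
    exact ENNReal.sum_le_tsum Z
  have hterm : ∀ ρ ∈ Z, ((riemannZetaZeroOrder (ρ : ℂ)).toNat : ℝ≥0∞) * ENNReal.ofReal (F (ρ : ℂ).im) ≠ ⊤ :=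
    fun ρ _ ↦ ENNReal.mul_ne_top (ENNReal.natCast_ne_top _) ENNReal.ofReal_ne_top
  have hR := ENNReal.toReal_mono hfin hle
  rw [ENNReal.toReal_sum hterm] at hR
  -- identify the terms (no `congr`/`rfl` on integrals: rewrite the point `½ + i Im ρ = ρ` only)
  have hFρ : ∀ ρ : riemannZetaNontrivialZeros, F (ρ : ℂ).im = ‖weilMellin g ρ‖ ^ 2 := by
    intro ρ
    show ‖weilMellin g (1 / 2 + (((ρ : ℂ).im : ℝ) : ℂ) * I)‖ ^ 2 = ‖weilMellin g ρ‖ ^ 2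
    rw [← eq_half_add_im_of_riemannHypothesis hRH ρ.2]
  have hid : ∀ ρ ∈ Z, (((riemannZetaZeroOrder (ρ : ℂ)).toNat : ℝ≥0∞) * ENNReal.ofReal (F (ρ : ℂ).im)).toReal =
      (riemannZetaZeroOrder (ρ : ℂ) : ℝ) * ‖weilMellin g ρ‖ ^ 2 := by
    intro ρ _
    rw [ENNReal.toReal_mul, ENNReal.toReal_natCast, ENNReal.toReal_ofReal (hF0 _), toNat_zeroOrder_cast ρ.2, hFρ ρ]
  rw [Finset.sum_congr rfl hid] at hR
  rw [hQre, hIl]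
  exact hR

/-- **Pinning at one zero, with multiplicity**: under RH, `m(ρ)·‖ĝ(ρ)‖² ≤ Re Q(g)` for every test `g` and every non-trivial zero `ρ`.
[cite: Bombieri2000Weil, §3 eq. (3.2)] -/
theorem zeroOrder_mul_norm_sq_weilMellin_le (hRH : _root_.RiemannHypothesis) (hg : IsWeilTest g) {ρ : ℂ}
    (hρ : ρ ∈ riemannZetaNontrivialZeros) :
    (riemannZetaZeroOrder ρ : ℝ) * ‖weilMellin g ρ‖ ^ 2 ≤ (weilQuadratic g).re := by
  have h := sum_zeroOrder_mul_norm_sq_weilMellin_le hRH hg {⟨ρ, hρ⟩}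
  rw [Finset.sum_singleton] at h
  exact h

/-- **Pinning at one zero**: under RH, `‖ĝ(ρ)‖² ≤ Re Q(g)` for every test `g` and every non-trivial zero `ρ` — a vector of Weil
energy `η` has `|ĝ(ρ)| ≤ √η` at EVERY zero. [cite: Bombieri2000Weil, §3 eq. (3.2)] -/
theorem norm_sq_weilMellin_le (hRH : _root_.RiemannHypothesis) (hg : IsWeilTest g) {ρ : ℂ}
    (hρ : ρ ∈ riemannZetaNontrivialZeros) : ‖weilMellin g ρ‖ ^ 2 ≤ (weilQuadratic g).re := by
  have hm : (1 : ℝ) ≤ riemannZetaZeroOrder ρ := by exact_mod_cast one_le_order hρ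
  exact (le_mul_of_one_le_left (by positivity) hm).trans (zeroOrder_mul_norm_sq_weilMellin_le hRH hg hρ)

/-- The «near-null» reading: under RH, if `Re Q(g) ≤ η` then `‖ĝ(ρ)‖² ≤ η` at every non-trivial zero. [cite: Bombieri2000Weil, §3 eq. (3.2)] -/
theorem norm_sq_weilMellin_le_of_re_weilQuadratic_le (hRH : _root_.RiemannHypothesis) (hg : IsWeilTest g) {η : ℝ}
    (hη : (weilQuadratic g).re ≤ η) {ρ : ℂ} (hρ : ρ ∈ riemannZetaNontrivialZeros) : ‖weilMellin g ρ‖ ^ 2 ≤ η :=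
  (norm_sq_weilMellin_le hRH hg hρ).trans hη

/-! ## §2 Logical status: the all-`g` pinning inequality is RH; one violation refutes RH -/

/-- The tree's certified first zero `ρ₁ = ½ + iγ₁`, `γ₁ ∈ [225/16, 227/16]`, is a non-trivial zero (so the zero set is non-empty,
unconditionally). [cite: Edwards1974, §6.6] -/
theorem exists_mem_riemannZetaNontrivialZeros : ∃ ρ : ℂ, ρ ∈ riemannZetaNontrivialZeros := by
  obtain ⟨γ, hγ, hz⟩ := exists_zero_Icc_first_bracket
  refine ⟨1 / 2 + γ * I, mem_of_im_ne_zero hz ?_⟩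
  have him : ((1 : ℂ) / 2 + γ * I).im = γ := by simp
  rw [him]
  linarith [hγ.1]

/-- **STATUS: the pinning inequality, for all tests and all zeros, IS the Riemann hypothesis.** `→` is §1; `←`: at the certified zero
`ρ₁` the inequality gives `Re Q(g) ≥ ‖ĝ(ρ₁)‖² ≥ 0` for every test `g`, i.e. Weil positivity, which is RH by Weil's criterion
(tree `weil_criterion_holds`). So the Mellin picture, read as a law for every vector, is RH and not a route around it.
[cite: Bombieri2000Weil, Thm 1–2] -/
theorem riemannHypothesis_iff_forall_norm_sq_weilMellin_le :
    _root_.RiemannHypothesis ↔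
      ∀ g : ℝ → ℂ, IsWeilTest g → ∀ ρ ∈ riemannZetaNontrivialZeros, ‖weilMellin g ρ‖ ^ 2 ≤ (weilQuadratic g).re := by
  constructor
  · exact fun hRH g hg ρ hρ ↦ norm_sq_weilMellin_le hRH hg hρ
  · intro h
    obtain ⟨ρ, hρ⟩ := exists_mem_riemannZetaNontrivialZeros
    refine weil_criterion_holds.2 fun g hg ↦ ?_
    exact le_trans (by positivity) (h g hg ρ hρ)

/-- **The falsifiable reading (RH-free): ONE test function and ONE non-trivial zero with `Re Q(g) < ‖ĝ(ρ)‖²` refute RH.**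
[cite: Bombieri2000Weil, §3 eq. (3.2)] -/
theorem not_riemannHypothesis_of_lt (hg : IsWeilTest g) {ρ : ℂ} (hρ : ρ ∈ riemannZetaNontrivialZeros)
    (hlt : (weilQuadratic g).re < ‖weilMellin g ρ‖ ^ 2) : ¬ _root_.RiemannHypothesis :=
  fun hRH ↦ (not_le.mpr hlt) (norm_sq_weilMellin_le hRH hg hρ)

/-- Finite form of the refutation: a finite set of zeros carrying more than the whole energy refutes RH. [cite: Bombieri2000Weil, §3 eq. (3.2)] -/
theorem not_riemannHypothesis_of_lt_sum (hg : IsWeilTest g) (Z : Finset riemannZetaNontrivialZeros)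
    (hlt : (weilQuadratic g).re < ∑ ρ ∈ Z, (riemannZetaZeroOrder (ρ : ℂ) : ℝ) * ‖weilMellin g ρ‖ ^ 2) :
    ¬ _root_.RiemannHypothesis :=
  fun hRH ↦ (not_le.mpr hlt) (sum_zeroOrder_mul_norm_sq_weilMellin_le hRH hg Z)

/-! ## §3 The handoff-window face: the budget is `contribution_q(g) − deficit_q(g)` -/

variable {q q' : ℕ}

/-- **Window budget.** Under RH, for consecutive primes `q < q'` and a test `g` supported in `[−(log q')/2, (log q')/2]`:
`Σ_{ρ ∈ Z} m(ρ)‖ĝ(ρ)‖² ≤ contribution_q(g) − deficit_q(g)` — the `{p < q}`-deleted form's value plus the one-atom contribution of `q`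
is the whole budget (REPORT §4m (a)'s `Q(g_N) = ε₁‖g‖² + w_q·m·‖g‖²_Λ`). [cite: Bombieri2000Weil, §3 eq. (3.2); Connes1999 §VII Thm 4 (window identity, tree)] -/
theorem sum_zeroOrder_mul_norm_sq_weilMellin_le_contribution_sub_deficit (hRH : _root_.RiemannHypothesis)
    (h : ConsecutivePrimes q q') (hg : IsWeilTest g)
    (hsupp : tsupport g ⊆ Icc (-(Real.log q' / 2)) (Real.log q' / 2)) (Z : Finset riemannZetaNontrivialZeros) :
    ∑ ρ ∈ Z, (riemannZetaZeroOrder (ρ : ℂ) : ℝ) * ‖weilMellin g ρ‖ ^ 2 ≤ contribution q g - deficit q g := by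
  rw [← re_weilQuadratic_eq_contribution_sub_deficit h hg hsupp]
  exact sum_zeroOrder_mul_norm_sq_weilMellin_le hRH hg Z

/-- One zero: under RH, on the window `‖ĝ(ρ)‖² ≤ contribution_q(g) − deficit_q(g)`. [cite: Bombieri2000Weil, §3 eq. (3.2)] -/
theorem norm_sq_weilMellin_le_contribution_sub_deficit (hRH : _root_.RiemannHypothesis) (h : ConsecutivePrimes q q')
    (hg : IsWeilTest g) (hsupp : tsupport g ⊆ Icc (-(Real.log q' / 2)) (Real.log q' / 2)) {ρ : ℂ}
    (hρ : ρ ∈ riemannZetaNontrivialZeros) : ‖weilMellin g ρ‖ ^ 2 ≤ contribution q g - deficit q g := by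
  rw [← re_weilQuadratic_eq_contribution_sub_deficit h hg hsupp]
  exact norm_sq_weilMellin_le hRH hg hρ

/-- **Deleted form + cap.** Under RH, for `g ∈ C(b)` with `b ≤ (log q')/2`:
`‖ĝ(ρ)‖² ≤ Re Q_{S_q}(g) + cap(q)·‖g‖₂²`, `cap(q) = (log q)/√q` — a vector on which the `{p < q}`-form is small (a near-null or wall
vector of the deleted form) is pinned at every zero up to the one-atom cap (the tree's `abs_contribution_le_of_window`; the sharper
layer form of the contribution is XII-q's `contribution_eq_layer`). [cite: Bombieri2000Weil, §3 eq. (3.2); ConnesConsani2023 §2.2–2.3 (one-prime contribution)] -/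
theorem norm_sq_weilMellin_le_semilocal_add_cap (hRH : _root_.RiemannHypothesis) (h : ConsecutivePrimes q q')
    (hg : IsWeilTest g) {b : ℝ} (hb : b ≤ Real.log q' / 2) (hsupp : tsupport g ⊆ Icc (-b) b) {ρ : ℂ}
    (hρ : ρ ∈ riemannZetaNontrivialZeros) :
    ‖weilMellin g ρ‖ ^ 2 ≤
      (weilSemilocalQuadratic (Nat.primesBelow q) g).re + Real.log q / Real.sqrt q * ∫ u : ℝ, ‖g u‖ ^ 2 := by
  have hsupp' : tsupport g ⊆ Icc (-(Real.log q' / 2)) (Real.log q' / 2) :=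
    hsupp.trans (Icc_subset_Icc (neg_le_neg hb) hb)
  have h1 := norm_sq_weilMellin_le_contribution_sub_deficit hRH h hg hsupp' hρ
  have h2 := abs_contribution_le_of_window h hg hb hsupp
  have h3 := le_abs_self (contribution q g)
  unfold deficit at h1
  linarith

/-- **Window refutation form (RH-free).** A test `g` on the window of the consecutive primes `q < q'` and a non-trivial zero `ρ`
with `contribution_q(g) − deficit_q(g) < ‖ĝ(ρ)‖²` refute RH: a certified wall vector that is NOT pinned at some zero beyond its
budget would be a disproof. (None is: REPORT §4m's vectors un-pin exactly at the budget.) [cite: Bombieri2000Weil, §3 eq. (3.2)] -/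
theorem not_riemannHypothesis_of_contribution_sub_deficit_lt (h : ConsecutivePrimes q q') (hg : IsWeilTest g)
    (hsupp : tsupport g ⊆ Icc (-(Real.log q' / 2)) (Real.log q' / 2)) {ρ : ℂ} (hρ : ρ ∈ riemannZetaNontrivialZeros)
    (hlt : contribution q g - deficit q g < ‖weilMellin g ρ‖ ^ 2) : ¬ _root_.RiemannHypothesis :=
  fun hRH ↦ (not_le.mpr hlt) (norm_sq_weilMellin_le_contribution_sub_deficit hRH h hg hsupp hρ)

/-! ## §4 ONE ZERO SUFFICES; the per-window pinning rungs sit between `H(q)` and RH (gen10 append)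

The barrier question of the track («is a partial law RH-equivalent?», PROVABLE-NOW T3) in Mellin clothes: pinning at a SINGLE
fixed zero, demanded of every test function, is already RH; and on each handoff window the pinning inequality for any finite zero
set `Z` is a rung that IMPLIES `H(q)` (take `Z` arbitrary: the left side is `≥ 0`) and is implied by RH — an intermediate,
finite-rank-perturbed positivity statement «`Q − Σ_{ρ∈Z} m(ρ)|·̂(ρ)|² ⪰ 0` on `C((log q⁺)/2)`», certifiable like `H(q)` itself. -/

/-- **One zero suffices.** For ANY fixed non-trivial zero `ρ₀`: `RH ↔ ∀ g test, ‖ĝ(ρ₀)‖² ≤ Re Q(g)` — a pinning law at a single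
zero, for all tests, is the Riemann hypothesis (`←`: the right side makes `Re Q ≥ 0`, Weil's criterion). [cite: Bombieri2000Weil, Thm 1–2] -/
theorem riemannHypothesis_iff_forall_norm_sq_weilMellin_le_at {ρ₀ : ℂ} (hρ₀ : ρ₀ ∈ riemannZetaNontrivialZeros) :
    _root_.RiemannHypothesis ↔ ∀ g : ℝ → ℂ, IsWeilTest g → ‖weilMellin g ρ₀‖ ^ 2 ≤ (weilQuadratic g).re := by
  constructor
  · exact fun hRH g hg ↦ norm_sq_weilMellin_le hRH hg hρ₀
  · intro h
    refine weil_criterion_holds.2 fun g hg ↦ ?_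
    exact le_trans (by positivity) (h g hg)

/-- **The per-window pinning rung implies `H(q)`** (RH-free): for consecutive primes `q < q'` and ANY finite set `Z` of
non-trivial zeros, if every test `g ∈ C((log q')/2)` obeys `Σ_{ρ∈Z} m(ρ)‖ĝ(ρ)‖² ≤ contribution_q(g) − deficit_q(g)`, then `H(q)`
(the window statement `HandoffH q q'`): the left side is non-negative. Conversely RH gives the rung
(`sum_zeroOrder_mul_norm_sq_weilMellin_le_contribution_sub_deficit`), so each rung sits between `H(q)` and RH.
[cite: Bombieri2000Weil, §4 (windows); this track] -/
theorem handoffH_of_forall_sum_zeroOrder_mul_norm_sq_weilMellin_le (h : ConsecutivePrimes q q')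
    (Z : Finset riemannZetaNontrivialZeros)
    (hZ : ∀ g : ℝ → ℂ, IsWeilTest g → tsupport g ⊆ Icc (-(Real.log q' / 2)) (Real.log q' / 2) →
      ∑ ρ ∈ Z, (riemannZetaZeroOrder (ρ : ℂ) : ℝ) * ‖weilMellin g ρ‖ ^ 2 ≤ contribution q g - deficit q g) :
    HandoffH q q' := by
  rw [handoffH_iff_weilPositivityOn h]
  intro g hg hsupp
  have h0 : 0 ≤ ∑ ρ ∈ Z, (riemannZetaZeroOrder (ρ : ℂ) : ℝ) * ‖weilMellin g ρ‖ ^ 2 :=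
    Finset.sum_nonneg fun ρ _ ↦ mul_nonneg
      (by exact_mod_cast le_trans (show (0 : ℤ) ≤ 1 by norm_num) (one_le_order ρ.2)) (by positivity)
  rw [re_weilQuadratic_eq_contribution_sub_deficit h hg hsupp]
  exact h0.trans (hZ g hg hsupp)

/-- **The rungs, all `q` at once, are RH**: `RH ↔ ∀ consecutive primes q < q', ∀ finite Z, ∀ g ∈ C((log q')/2),
Σ_{ρ∈Z} m(ρ)‖ĝ(ρ)‖² ≤ contribution_q(g) − deficit_q(g)` (`→` §3; `←` with `Z = ∅` this is `∀ q H(q)`, the tree's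
`Handoff.riemannHypothesis_iff_forall_handoffH`). [cite: Bombieri2000Weil, Thm 1–2, §4] -/
theorem riemannHypothesis_iff_forall_window_pinning :
    _root_.RiemannHypothesis ↔ ∀ q q' : ℕ, ConsecutivePrimes q q' → ∀ Z : Finset riemannZetaNontrivialZeros,
      ∀ g : ℝ → ℂ, IsWeilTest g → tsupport g ⊆ Icc (-(Real.log q' / 2)) (Real.log q' / 2) →
        ∑ ρ ∈ Z, (riemannZetaZeroOrder (ρ : ℂ) : ℝ) * ‖weilMellin g ρ‖ ^ 2 ≤ contribution q g - deficit q g := by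
  constructor
  · exact fun hRH q q' h Z g hg hsupp ↦
      sum_zeroOrder_mul_norm_sq_weilMellin_le_contribution_sub_deficit hRH h hg hsupp Z
  · intro h
    have hH : ∀ q q' : ℕ, ConsecutivePrimes q q' → HandoffH q q' := fun q q' hqq' ↦
      handoffH_of_forall_sum_zeroOrder_mul_norm_sq_weilMellin_le hqq' ∅ (fun g hg hsupp ↦ by
        simpa using h q q' hqq' ∅ g hg hsupp)
    exact Handoff.riemannHypothesis_iff_forall_handoffH.2 hH

/-! ## §5 The SINE-TRANSFORM face (odd sector): `ĝ(½+iγ) = i∫ g(t) sin(γt) dt`, and the per-pair budget `2‖∫ g sin(γ·)‖² ≤ Re Q(g)` (gen10 append)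

This is the object the cell's numerics evaluate (REPORT §4m′: `F(γ) = ∫₀^b u sin(γu) du = ½∫_ℝ g sin`, each zero PAIR `±γ` carrying `8F²`).
For an ODD test `g` the transform on the critical line is `i` times the (full-line) sine transform, and for a REAL odd test
the two conjugate zeros `ρ, ρ̄` carry the same weight, so the finite-form pinning inequality with `Z = {ρ, ρ̄}` reads
`2‖∫ g(t) sin(γt) dt‖² ≤ Re Q(g)` under RH (`= 8(∫₀^∞ g sin)²`). -/

/-- **Odd sector: the Mellin transform on the critical line is `i` × the sine transform.** For an odd Weil test function `g`
(`g(−t) = −g(t)`) and real `γ`: `ĝ(½ + iγ) = i·∫ g(t) sin(γt) dt` (the cosine part dies by oddness; `= 2i∫₀^∞ g sin` for the cell's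
half-line `F`). [cite: Bombieri2000Weil, Thm 2 (the transform `ĝ(s) = ∫ g(t)e^{(s−½)t}dt`); parity bookkeeping: this track] -/
theorem weilMellin_half_add_mul_I_of_odd (hg : IsWeilTest g) (hodd : ∀ t, g (-t) = -g t) (γ : ℝ) :
    weilMellin g (1 / 2 + γ * I) = I * ∫ t : ℝ, g t * (Real.sin (γ * t) : ℂ) := by
  unfold weilMellin
  have hexp : ∀ t : ℝ, cexp ((1 / 2 + (γ : ℂ) * I - 1 / 2) * (t : ℂ)) =
      (Real.cos (γ * t) : ℂ) + (Real.sin (γ * t) : ℂ) * I := by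
    intro t
    have : (1 / 2 + (γ : ℂ) * I - 1 / 2) * (t : ℂ) = ((γ * t : ℝ) : ℂ) * I := by push_cast; ring
    rw [this, Complex.exp_mul_I, ← Complex.ofReal_cos, ← Complex.ofReal_sin]
  have hcont : Continuous g := hg.1.continuous
  have hci : ∀ (φ : ℝ → ℂ), Continuous φ → Integrable (fun t ↦ g t * φ t) := fun φ hφ ↦
    (hcont.mul hφ).integrable_of_hasCompactSupport (hg.2.mul_right)
  have hcosI : Integrable (fun t : ℝ ↦ g t * (Real.cos (γ * t) : ℂ)) :=
    hci _ (Complex.continuous_ofReal.comp (Real.continuous_cos.comp (continuous_const.mul continuous_id)))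
  have hsinI : Integrable (fun t : ℝ ↦ g t * ((Real.sin (γ * t) : ℂ) * I)) :=
    hci _ ((Complex.continuous_ofReal.comp (Real.continuous_sin.comp (continuous_const.mul continuous_id))).mul
      continuous_const)
  have hsplit : (fun t : ℝ ↦ g t * cexp ((1 / 2 + (γ : ℂ) * I - 1 / 2) * (t : ℂ))) =
      fun t ↦ g t * (Real.cos (γ * t) : ℂ) + g t * ((Real.sin (γ * t) : ℂ) * I) := by
    funext t; rw [hexp t]; ring
  rw [hsplit, integral_add hcosI hsinI]
  -- the cosine part is odd, hence vanishes
  have hcos0 : ∫ t : ℝ, g t * (Real.cos (γ * t) : ℂ) = 0 := by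
    -- the integrand `h` is odd: `∫ h(−t) = ∫ h` (Haar) and `∫ h(−t) = −∫ h`, so `2∫h = 0`
    -- (the tree's `Theorems.integral_eq_zero_of_odd`, `WeilGroundStateGroundStateSimpleEvenStubTransfer`, inlined to keep this file's imports)
    set h : ℝ → ℂ := fun t ↦ g t * (Real.cos (γ * t) : ℂ) with hh
    have hodd' : ∀ t, h (-t) = -h t := fun t ↦ by
      have : Real.cos (γ * -t) = Real.cos (γ * t) := by rw [mul_neg, Real.cos_neg]
      simp only [hh, hodd, this]; ring
    have h1 : ∫ t, h (-t) = ∫ t, h t := integral_neg_eq_self h volume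
    have h2 : ∫ t, h (-t) = -∫ t, h t := by
      rw [← integral_neg]; exact integral_congr_ae (Filter.Eventually.of_forall fun t ↦ hodd' t)
    have h3 : ∫ t, h t = -∫ t, h t := h1.symm.trans h2
    linear_combination h3 / 2
  rw [hcos0, zero_add]
  have : (fun t : ℝ ↦ g t * ((Real.sin (γ * t) : ℂ) * I)) = fun t ↦ I * (g t * (Real.sin (γ * t) : ℂ)) := by
    funext t; ring
  rw [this, integral_const_mul]

/-- For a REAL-valued test function the transform at conjugate points is conjugate: `ĝ(s̄) = conj ĝ(s)`. [folklore] -/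
theorem weilMellin_conj_of_real (hreal : ∀ t, conj (g t) = g t) (s : ℂ) :
    weilMellin g (conj s) = conj (weilMellin g s) := by
  unfold weilMellin
  rw [← integral_conj]
  refine integral_congr_ae (Filter.Eventually.of_forall fun t ↦ ?_)
  show g t * cexp ((conj s - 1 / 2) * (t : ℂ)) = conj (g t * cexp ((s - 1 / 2) * (t : ℂ)))
  rw [map_mul, hreal t, ← Complex.exp_conj, map_mul, map_sub, Complex.conj_ofReal, map_div₀, map_one,
    map_ofNat]

/-- **THE PER-PAIR BUDGET (odd, real test functions).** Under RH, for a real-valued odd Weil test function `g` and a non-trivial zero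
`ρ = ½ + iγ`: `2·‖∫ g(t) sin(γt) dt‖² ≤ Re Q(g)` — the pair `ρ, ρ̄` carries `|ĝ(ρ)|² + |ĝ(ρ̄)|² = 2|∫ g sin γt|² = 8(∫₀^∞ g sin γt)²` of the
Weil energy (the finite form `sum_zeroOrder_mul_norm_sq_weilMellin_le` with `Z = {ρ, ρ̄}`, `ρ ≠ ρ̄` since `Im ρ ≠ 0`, multiplicities `≥ 1`).
This is the inequality the cell's Mellin tables check zero pair by zero pair (`Z_K = 8Σ_{k≤K}F(γ_k)² ≤ Q(g_N)`).
[cite: Bombieri2000Weil, §3 eq. (3.2); this track (REPORT §4m′)] -/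
theorem two_mul_norm_sq_integral_sin_le (hRH : _root_.RiemannHypothesis) (hg : IsWeilTest g)
    (hodd : ∀ t, g (-t) = -g t) (hreal : ∀ t, conj (g t) = g t) {ρ : ℂ} (hρ : ρ ∈ riemannZetaNontrivialZeros) :
    2 * ‖∫ t : ℝ, g t * (Real.sin (ρ.im * t) : ℂ)‖ ^ 2 ≤ (weilQuadratic g).re := by
  have hρ' : conj ρ ∈ riemannZetaNontrivialZeros := conj_mem hρ
  have hne : (⟨ρ, hρ⟩ : riemannZetaNontrivialZeros) ≠ ⟨conj ρ, hρ'⟩ := by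
    intro h
    have him : ρ.im = (conj ρ).im := by rw [show conj ρ = ρ from (Subtype.mk.inj h).symm]
    rw [Complex.conj_im] at him
    exact im_ne_zero hρ (by linarith)
  -- the pair as a finset
  have hsum := sum_zeroOrder_mul_norm_sq_weilMellin_le hRH hg {⟨ρ, hρ⟩, ⟨conj ρ, hρ'⟩}
  rw [Finset.sum_pair hne] at hsum
  -- both values equal ‖∫ g sin‖
  have hρeq : ρ = 1 / 2 + (ρ.im : ℂ) * I := eq_half_add_im_of_riemannHypothesis hRH hρ
  have hval : ‖weilMellin g ρ‖ = ‖∫ t : ℝ, g t * (Real.sin (ρ.im * t) : ℂ)‖ := by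
    rw [hρeq, weilMellin_half_add_mul_I_of_odd hg hodd, norm_mul, Complex.norm_I, one_mul]
    simp
  have hval' : ‖weilMellin g (conj ρ)‖ = ‖weilMellin g ρ‖ := by
    rw [weilMellin_conj_of_real hreal, Complex.norm_conj]
  have hm1 : (1 : ℝ) ≤ riemannZetaZeroOrder ρ := by exact_mod_cast one_le_order hρ
  have hm2 : (1 : ℝ) ≤ riemannZetaZeroOrder (conj ρ) := by exact_mod_cast one_le_order hρ'
  have h0 : 0 ≤ ‖weilMellin g ρ‖ ^ 2 := by positivity
  have key : 2 * ‖weilMellin g ρ‖ ^ 2 ≤ (weilQuadratic g).re := by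
    have e1 : ‖weilMellin g ρ‖ ^ 2 ≤ (riemannZetaZeroOrder ρ : ℝ) * ‖weilMellin g ρ‖ ^ 2 :=
      le_mul_of_one_le_left h0 hm1
    have e2 : ‖weilMellin g ρ‖ ^ 2 ≤ (riemannZetaZeroOrder (conj ρ) : ℝ) * ‖weilMellin g (conj ρ)‖ ^ 2 := by
      rw [hval']; exact le_mul_of_one_le_left h0 hm2
    have := add_le_add e1 e2
    simpa [two_mul] using this.trans (by simpa using hsum)
  rwa [hval] at key

end Summit.RiemannHypothesis.RiemannHypothesis.Theorems.HandoffMellinPinning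

end
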